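import Mathlib
import HarnessLib
import Summits.HubbardSuperconductivity.HubbardSuperconductivity.Theorems.KLProgrammeKLRegimeEngineIsoResectorisation
import Summits.HubbardSuperconductivity.HubbardSuperconductivity.Theorems.KLProgrammeKLRegimeEngineScaleZeroE1Sizes
import Summits.HubbardSuperconductivity.HubbardSuperconductivity.Theorems.KLProgrammeKLRegimeEngineScaleZeroE1Regime
import Summits.HubbardSuperconductivity.HubbardSuperconductivity.Theorems.KLProgrammeKLRegimeEngineScaleZeroE1Gfr0

/-!
# Route `KLProgramme` — ENGINE item stmt-HubbardSuperconductivity-20437, class #6 (`IsoTupleLineAt`, (X).2) PRODUCER SIDE: the scale-`0` thin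
# family's SINGLE character sum, exported, and the thin-index-`0` twin of the iso ← thin door (the case `n = 1` of the class-#6 line)

Cell gate-hubbard-kl, seat hubbard-kl-k3c2-p2 (g10).  `…EngineIsoResectorisation` (p563457) turns one per-THIN-tuple line of index `n₂ ≥ 1` into
`IsoTupleLineAt … n` for every `n ≥ n₂ + 1`; the thin single character sum it consumes is the neighbouring-pair one (`charSum_klAniso_single_le`,
`n₂ ≥ 1`).  At scale `n = 1` the producer's own index is `n₂ = 0`: the two-sector scale-`0` family `klAnisoFamily … klE0 0`, whose product-torus
character sum was bounded by k3c2-p1 INSIDE `klAnisoLegKernelNorm_zero_le_explicit` ((E1-v4)₀ of `stub_engine_scale0`: the symbol data `hsupp/h₀/h₁`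
of `torusSum_le_of_symbol_bounds` on an admissible frame) but never exported as a statement.  This file exports it and closes the twin:

* §1 **`torusSum_klAnisoFamily_zero_le_explicit`** — the `(ℤ/4M) × (ℤ/L)²`-padded character sum of `klAnisoFamily … klE0 0 ω` (both charges) on an
  admissible frame (`FrameOK`, `Gfr ≥ 0`, `μ ∈ klWindowC`, `(16/15)Gfr0|U| ≤ 1/50`, `2^15 ≤ L`, `klBetaMin ≤ β`, `2 ≤ M`, `klE0·β ≤ π(2M−3)`):
  `(|β|L²)⁻¹·Σ_{dw}‖Σ_k F_{0,ω}(k)Χ_c(k;dw)‖ ≤ (|β|L²)⁻¹·√(2048(1/s₀+1)Φ(s₁))·√(16·4M·L²·N_s)` with k3c2-p1's `s₀ = βe₀/(16πM)`, `s₁ = 2/(π(C_s⋆+1))`,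
  `N_s` = the frequency-window × frame-shell count (the `have`s of `…ScaleZeroExplicit`, verbatim, + `torusSum_le_of_symbol_bounds`);
  **`torusSum_klAnisoFamily_zero_le_CT`** — `≤ C_T⁰·(M/β)` with the CLOSED constant of `scaleZero_T_le` (`β ≤ M` in addition);
* §2 `charSum_le_of_padded_le` (generic: a bound `B` on the normalised padded sum gives the `(ℤ/2M) × (ℤ/L)²` sum `≤ |β|L²·B`, via `charSum_l1_le_padded`)
  and **`charSum_klAniso_zero_single_klEng`** — `∃ C₀ > 0`: under the binders of the registered stubs of 20437 (klEngC₃6/U₀9/L₃/M₃, `FrameOK`) every scale-`0`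
  thin multiplier has `Σ_z‖Σ_q χ_q(z)·F_{0,a}(k_q)‖ ≤ C₀·M·L²` (sizes by `scaleZero_regime_sizes`, `(16/15)Gfr0|U| ≤ 1/50` by `gfr0_abs_mul_le_of_le_klEngU₀3`);
* §3 **`overlap_pairSums_klIso_zero_klEng`** (`∃ C_I⁰`: per-pair column/row sums of `E(klIsoFamily m)·S(F̃_0)` `≤ C_I⁰·M/β`, every `m ≥ 1`) and
  **THE n₂ = 0 DOOR `isoTupleLineAt_of_anisoTupleLine_zero_klEng`** — `∃ C_re⁰ > 0`: for every `1 ≤ n`, a per-thin-tuple line of `𝒱_n[K_n]` at thin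
  index `0` (`ε³·Σ_{x′_p=y}‖klAnisoKernelAt … K_n n 0 σ′ x′‖ ≤ a·U + b·(Klam U)²`) gives `IsoTupleLineAt L M (C_re⁰·a) (C_re⁰·b) P β U μ n` — with p563457
  the class-#6 door now covers EVERY scale `n ≥ 1` at the producer's index `n − 1` (`n = 0`: p556867/p557506).

Everything is proved; no definitions; nothing about the model is asserted beyond these implications.
[cite: BenfattoGiulianiMastropietro2006, §2.5 (2.45)–(2.48), §2.7 (2.71a), §2.8 (2.82)–(2.83)]
-/

noncomputable section

namespace Summit.HubbardSuperconductivity.HubbardSuperconductivity.Theorems.EngineV8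

set_option linter.dupNamespace false -- summit = problem name (single-conjunct summit), D-0017

open Classical
open Real Finset Literature.MathematicalPhysics.QuantumLattice Literature.Probability.LatticeModels GrassmannAlgebra
open Literature.MathematicalPhysics.QuantumLattice.FermiRG
open Summit.HubbardSuperconductivity.HubbardSuperconductivity.Theorems.KLProgrammeLegKernels
open Summit.HubbardSuperconductivity.HubbardSuperconductivity.Theorems.KLRegimeSplit
open Summit.HubbardSuperconductivity.HubbardSuperconductivity.Theorems.TorusFourierL2
open Summit.HubbardSuperconductivity.HubbardSuperconductivity.Theorems.ScaleZeroDecay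
open scoped ComplexConjugate

variable {L M : ℕ} [NeZero L]

/-! ## §1 The padded character sum of the scale-`0` thin family on an admissible frame -/

/-- **The product-torus character sum of the scale-`0` thin multiplier, explicit** (k3c2-p1's symbol data of `klAnisoLegKernelNorm_zero_le_explicit`
fed to `torusSum_le_of_symbol_bounds`, exported): on an admissible frame in the regime, for every sector `ω` of index `0` and charge `c`,
`(|β|L²)⁻¹·Σ_{dw}‖Σ_k F_{0,ω}(k)Χ_c(k;dw)‖ ≤ (|β|L²)⁻¹·√(2048(1/s₀+1)Φ(s₁))·√(16·4M·L²·N_s)`, `s₀ = β·klE0/(16πM)`, `s₁ = 2/(π(C_s⋆+1))`,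
`N_s = #({|ω̃| < klE0} ×ˢ {|e_K| < klE0})`. [cite: BenfattoGiulianiMastropietro2006, §2.7 (2.71a)] -/
theorem torusSum_klAnisoFamily_zero_le_explicit [NeZero M] {R : RenConsts} {U : ℝ} {N : ℕ} {μ : ℝ} {K : TrigPolyC4v}
    (hK : FrameOK R U N μ K) (hR : ∀ j, 0 ≤ R.Gfr j) (hμ : μ ∈ klWindowC) (hκU : 16 / 15 * (R.Gfr 0 * |U|) ≤ 1 / 50)
    (hL : (2 : ℝ) ^ 15 ≤ L) {β : ℝ} (hβ : klBetaMin ≤ β) (hM2 : 2 ≤ M) (hMβ : klE0 * β ≤ Real.pi * (2 * M - 3))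
    (ω : Fin (sectorCount 0)) (c : Fin 2) :
    1 / (|β| * (L : ℝ) ^ 2) *
        ∑ dw : TorusSite 1 (2 * (2 * M)) × TorusSite 2 L, ‖∑ k : FreqMomentum L M, klAnisoFamily L M β μ K klE0 0 ω k *
          (if c = 0 then torusChar (fun _ : Fin 1 => ((k.1 : ℕ) : ZMod (2 * (2 * M)))) dw.1 * torusChar k.2 dw.2
            else conj (torusChar (fun _ : Fin 1 => ((k.1 : ℕ) : ZMod (2 * (2 * M)))) dw.1 * torusChar k.2 dw.2))‖ ≤
      1 / (|β| * (L : ℝ) ^ 2) *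
        (Real.sqrt (2048 * (1 / (β * klE0 / (16 * Real.pi * M)) + 1) *
            (4 * ((2 * Real.sqrt 2 / (2 / (Real.pi * ((22484224 / 9 + 7180 / 3 * sectorCircLineConst) + 1))) + 2) *
              (2 * Real.sqrt 2 / (2 / (Real.pi * ((22484224 / 9 + 7180 / 3 * sectorCircLineConst) + 1))) + 2)) +
              16 * (1 / (2 / (Real.pi * ((22484224 / 9 + 7180 / 3 * sectorCircLineConst) + 1))) + 1) ^ 2)) *
          Real.sqrt (16 * (2 * (2 * M) : ℕ) * (L : ℝ) ^ 2 *
            ((((univ : Finset (TorusSite 1 (2 * (2 * M)))).filter fun q₁ => |gridFreq M (2 * (2 * M)) β q₁| < klE0) ×ˢ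
              ((univ : Finset (TorusSite 2 L)).filter fun k => |nambuXiCT L μ K k| < klE0)).card : ℕ))) := by
  -- elementary sizes
  have he : (0 : ℝ) < klE0 := by norm_num [klE0]
  have hβpos : 0 < β := lt_of_lt_of_le (by norm_num [klBetaMin]) hβ
  have hLpos : (0 : ℝ) < L := lt_of_lt_of_le (by norm_num) hL
  have hM2' : (2 : ℝ) ≤ M := by exact_mod_cast hM2
  have hMpos : (0 : ℝ) < M := by linarith
  have hE : klE0 = 1 / 32 := by norm_num [klE0]
  have hπ := Real.pi_pos
  have hπ4 : Real.pi < 3.1416 := Real.pi_lt_d4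
  have hB := sectorCircLineConst_nonneg
  have hCs : 0 ≤ (22484224 / 9 + 7180 / 3 * sectorCircLineConst) := by positivity
  obtain ⟨hμ1, hμ2⟩ := hμ
  -- `κ = sup|K|`
  have hKκ : ∀ q : Fin 2 → ℝ, |K.eval q| ≤ 16 / 15 * (R.Gfr 0 * |U|) := abs_eval_le_of_frameOK hK hR
  -- the parameters
  set s₀ : ℝ := β * klE0 / (16 * Real.pi * M) with hs₀
  set s₁ : ℝ := 2 / (Real.pi * ((22484224 / 9 + 7180 / 3 * sectorCircLineConst) + 1)) with hs₁
  have hs₀pos : 0 < s₀ := by rw [hs₀]; positivity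
  have hs₁pos : 0 < s₁ := by rw [hs₁]; positivity
  -- geometry of the lattice: `4π/L ≤ 2^{-11}`
  have h4πL : 4 * Real.pi / L ≤ 1 / 2 ^ 11 := by
    rw [div_le_iff₀ hLpos]
    have : (4 : ℝ) * Real.pi ≤ 2 ^ 4 := by linarith
    calc 4 * Real.pi ≤ 2 ^ 4 := this
      _ = 1 / 2 ^ 11 * 2 ^ 15 := by norm_num
      _ ≤ 1 / 2 ^ 11 * L := by gcongr
  have hL8 : 8 < L := by
    have : (8 : ℝ) < L := lt_of_lt_of_le (by norm_num) hL
    exact_mod_cast this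
  have hL8' : 8 ≤ L := hL8.le
  -- (hsupp)
  have hMβ' : klE0 * β ≤ Real.pi * (2 * M + 1) := hMβ.trans (mul_le_mul_of_nonneg_left (by linarith) hπ.le)
  have hsupp := fun ω : Fin (sectorCount 0) => card_support_scaleZeroPadded_le (L := L) hβpos hMβ' μ K ω
  -- (h₀) numeric time bound
  have hMN : 2 * M ≤ 2 * (2 * M) := by omega
  have h₀ : ∀ (ω : Fin (sectorCount 0)) (q : TorusSite 1 (2 * (2 * M)) × TorusSite 2 L),
      ‖(fwdDiff ((fun _ : Fin 1 => (1 : ZMod (2 * (2 * M)))), (0 : TorusSite 2 L)))^[2]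
        (fun q : TorusSite 1 (2 * (2 * M)) × TorusSite 2 L =>
          if h : (q.1 0).val < 2 * M then klAnisoFamily L M β μ K klE0 0 ω (⟨(q.1 0).val, h⟩, q.2) else 0) q‖ ≤
        (4 / (s₀ * (2 * (2 * M) : ℕ))) ^ 2 := by
    intro ω q
    rw [scaleZeroPadded_eq_bgmGridSymbol]
    refine (norm_fwdDiff_two_time_bgmGridSymbol_prod_le he hβpos hM2 hMN hMβ μ K ω q).trans ?_
    have hval : (4 / (s₀ * (2 * (2 * M) : ℕ))) ^ 2 = 256 * Real.pi ^ 2 / (β ^ 2 * klE0 ^ 2) := by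
      rw [hs₀]
      push_cast
      field_simp
      ring
    rw [hval, div_pow, le_div_iff₀ (by positivity)]
    field_simp
    nlinarith [sq_nonneg Real.pi, sq_nonneg β, he]
  -- (h₁) numeric space bound with the frame geometry
  have hzone : ∀ (l : Fin 2) (k : TorusSite 2 L), |2 * (((k l).val : ℤ)) - L| ≤ 4 → klE0 ≤ |nambuXiCT L μ K k| := by
    intro l k hk
    refine le_abs_nambuXiCT_of_boundary hL8' hKκ ?_ l k hk
    have hcos : 1 - (4 * Real.pi / L) ^ 2 / 2 ≤ Real.cos (4 * Real.pi / L) := Real.one_sub_sq_div_two_le_cos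
    have hsmall : (4 * Real.pi / L) ^ 2 ≤ (1 / 2 ^ 11) ^ 2 := pow_le_pow_left₀ (by positivity) h4πL 2
    rw [hE]
    norm_num at hsmall ⊢
    nlinarith [hcos, hsmall, hμ2, hκU]
  have hr : ∀ k : TorusSite 2 L, |nambuXiCT L μ K k| < klE0 → (17 / 10 : ℝ) ≤ ‖momToComplex (torusCentredMomentum L k)‖ := by
    intro k hk
    refine le_norm_centred_of_abs_nambuXiCT_lt hKκ ?_ k hk
    rw [hE]
    norm_num
    linarith [hμ1, hκU]
  have hr₁ : 4 * Real.pi / L < 17 / 10 := lt_of_le_of_lt h4πL (by norm_num)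
  have hx : 3 / (17 / 10 - 4 * Real.pi / L) ≤ 2 := by
    rw [div_le_iff₀ (by linarith)]
    have : 4 * Real.pi / L ≤ 1 / 2 ^ 11 := h4πL
    linarith
  have hx0 : 0 ≤ 3 / (17 / 10 - 4 * Real.pi / L) := by
    have : 0 < 17 / 10 - 4 * Real.pi / L := by linarith
    positivity
  have hD := uvLineBound_of_frameOK hK
  have h₁ : ∀ (ω : Fin (sectorCount 0)) (q : TorusSite 1 (2 * (2 * M)) × TorusSite 2 L) (i : Fin 2),
      ‖(fwdDiff ((0 : TorusSite 1 (2 * (2 * M))), (Pi.single i (1 : ZMod L) : TorusSite 2 L)))^[2]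
        (fun q : TorusSite 1 (2 * (2 * M)) × TorusSite 2 L =>
          if h : (q.1 0).val < 2 * M then klAnisoFamily L M β μ K klE0 0 ω (⟨(q.1 0).val, h⟩, q.2) else 0) q‖ ≤ (4 / (s₁ * L)) ^ 2 := by
    intro ω q i
    rw [scaleZeroPadded_eq_bgmGridSymbol]
    refine (norm_fwdDiff_two_space_bgmGridSymbol_prod_le (M := M) (N := 2 * (2 * M)) (β := β) he hL8 hD i (hzone i) hr hr₁ ω q).trans ?_
    set x : ℝ := 3 / (17 / 10 - 4 * Real.pi / L) with hxdef
    have hCsL : 448 / (9 * klE0 ^ 2) * 7 ^ 2 + 8 / (3 * klE0) * 7 + 2 * (8 / (3 * klE0) * 7) * (sectorCircLineConst * x) +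
        sectorCircLineConst * x ^ 2 ≤ (22484224 / 9 + 7180 / 3 * sectorCircLineConst) := by
      have h1 : sectorCircLineConst * x ≤ sectorCircLineConst * 2 := mul_le_mul_of_nonneg_left hx hB
      have h2 : sectorCircLineConst * x ^ 2 ≤ sectorCircLineConst * 2 ^ 2 :=
        mul_le_mul_of_nonneg_left (pow_le_pow_left₀ hx0 hx 2) hB
      rw [hE]
      norm_num
      nlinarith [h1, h2, hB]
    have hval : (4 / (s₁ * L)) ^ 2 = (2 * Real.pi / L) ^ 2 * ((22484224 / 9 + 7180 / 3 * sectorCircLineConst) + 1) ^ 2 := by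
      rw [hs₁]
      field_simp
      ring
    rw [hval]
    refine mul_le_mul_of_nonneg_left (hCsL.trans ?_) (by positivity)
    nlinarith
  -- the product-torus bound
  exact torusSum_le_of_symbol_bounds β (klAnisoFamily L M β μ K klE0 0) (conj_klAnisoFamily β μ K klE0 0)
    (fun ω k => norm_bgmMultiplier_le_one klE0 β _ 0 ω k) hs₀pos hs₁pos hsupp h₀ h₁ ω c

/-- **The same with the `β/L/M` cancellation** (k3c2-p1's `scaleZero_T_le`; `β ≤ M` in addition): the padded character sum of the scale-`0` thin
multiplier is `≤ C_T⁰·(M/β)` with the closed absolute constant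
`C_T⁰ = √(2048(16π/klE0+1)Φ(s₁))·√(64·1794·klE0·(klE0/π + 1/klBetaMin))`. [cite: BenfattoGiulianiMastropietro2006, §2.7 (2.71a)] -/
theorem torusSum_klAnisoFamily_zero_le_CT [NeZero M] {R : RenConsts} {U : ℝ} {N : ℕ} {μ : ℝ} {K : TrigPolyC4v}
    (hK : FrameOK R U N μ K) (hR : ∀ j, 0 ≤ R.Gfr j) (hμ : μ ∈ klWindowC) (hκU : 16 / 15 * (R.Gfr 0 * |U|) ≤ 1 / 50)
    (hL : (2 : ℝ) ^ 15 ≤ L) {β : ℝ} (hβ : klBetaMin ≤ β) (hβM : β ≤ M) (hM2 : 2 ≤ M) (hMβ : klE0 * β ≤ Real.pi * (2 * M - 3))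
    (ω : Fin (sectorCount 0)) (c : Fin 2) :
    1 / (|β| * (L : ℝ) ^ 2) *
        ∑ dw : TorusSite 1 (2 * (2 * M)) × TorusSite 2 L, ‖∑ k : FreqMomentum L M, klAnisoFamily L M β μ K klE0 0 ω k *
          (if c = 0 then torusChar (fun _ : Fin 1 => ((k.1 : ℕ) : ZMod (2 * (2 * M)))) dw.1 * torusChar k.2 dw.2
            else conj (torusChar (fun _ : Fin 1 => ((k.1 : ℕ) : ZMod (2 * (2 * M)))) dw.1 * torusChar k.2 dw.2))‖ ≤
      Real.sqrt (2048 * (16 * Real.pi / klE0 + 1) *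
            (4 * ((2 * Real.sqrt 2 / (2 / (Real.pi * ((22484224 / 9 + 7180 / 3 * sectorCircLineConst) + 1))) + 2) *
              (2 * Real.sqrt 2 / (2 / (Real.pi * ((22484224 / 9 + 7180 / 3 * sectorCircLineConst) + 1))) + 2)) +
              16 * (1 / (2 / (Real.pi * ((22484224 / 9 + 7180 / 3 * sectorCircLineConst) + 1))) + 1) ^ 2)) *
        Real.sqrt (64 * (1794 * klE0) * (klE0 / Real.pi + 1 / klBetaMin)) * ((M : ℝ) / β) := by
  have hβpos : 0 < β := lt_of_lt_of_le (by norm_num [klBetaMin]) hβ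
  have hB := sectorCircLineConst_nonneg
  have hΦ : 0 ≤ (4 * ((2 * Real.sqrt 2 / (2 / (Real.pi * ((22484224 / 9 + 7180 / 3 * sectorCircLineConst) + 1))) + 2) *
              (2 * Real.sqrt 2 / (2 / (Real.pi * ((22484224 / 9 + 7180 / 3 * sectorCircLineConst) + 1))) + 2)) +
              16 * (1 / (2 / (Real.pi * ((22484224 / 9 + 7180 / 3 * sectorCircLineConst) + 1))) + 1) ^ 2) := by
    positivity
  refine (torusSum_klAnisoFamily_zero_le_explicit hK hR hμ hκU hL hβ hM2 hMβ ω c).trans ?_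
  exact scaleZero_T_le hβ hβM hL hΦ (Nat.cast_nonneg _) (card_freqWindow_mul_shell_le_of_frameOK hK hβpos)

/-! ## §2 The scale-`0` thin single in the `(ℤ/2M) × (ℤ/L)²` convention, in the KL regime -/

/-- **From a bound on the normalised padded sum to the `2M`-torus single sum**: for any symbol `F`, if `(|β|L²)⁻¹·Σ_{dw}‖Σ_k F(k)χ^{(4M)}_{k₀}(d)χ_{k⃗}(w)‖ ≤ B`
then `Σ_z‖Σ_q χ_q(z)·F(k_q)‖ ≤ |β|L²·B` (`β ≠ 0`; `charSum_l1_le_padded`). [cite: BenfattoGiulianiMastropietro2006, §2.7 (2.71a)] -/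
theorem charSum_le_of_padded_le [NeZero M] {β : ℝ} (hβ : β ≠ 0) (F : FreqMomentum L M → ℂ) {B : ℝ}
    (hB : 1 / (|β| * (L : ℝ) ^ 2) * ∑ dw : TorusSite 1 (2 * (2 * M)) × TorusSite 2 L, ‖∑ k : FreqMomentum L M, F k *
          (torusChar (fun _ : Fin 1 => ((k.1 : ℕ) : ZMod (2 * (2 * M)))) dw.1 * torusChar k.2 dw.2)‖ ≤ B) :
    ∑ z : TorusSite 1 (2 * M) × TorusSite 2 L,
      ‖∑ q : TorusSite 1 (2 * M) × TorusSite 2 L, (torusChar q.1 z.1 * torusChar q.2 z.2) •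
        F (⟨(q.1 0).val, ZMod.val_lt (q.1 0)⟩, q.2)‖ ≤ |β| * (L : ℝ) ^ 2 * B := by
  have hL : (0 : ℝ) < L := Nat.cast_pos.2 (Nat.pos_of_ne_zero (NeZero.ne L))
  have hc : 0 < |β| * (L : ℝ) ^ 2 := by have := abs_pos.2 hβ; positivity
  refine (charSum_l1_le_padded F).trans ?_
  have h := mul_le_mul_of_nonneg_left hB hc.le
  rwa [← mul_assoc, mul_one_div_cancel hc.ne', one_mul] at h

/-- **The scale-`0` thin single character sum in the KL regime**: `∃ C₀ > 0` such that, under the binders of the registered stubs of item 20437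
(`P.WF`, `R.WF2`, `0 < c ≤ klEngC₃6 P R`, `μ ∈ klWindowC`, `0 < U ≤ klEngU₀9 P R c`, `klBetaMin ≤ β ≤ e^{c/U²}`, `FrameOK R U (nScales β) μ K`,
`klEngL₃ β U ≤ L`, `klEngM₃ β U L ≤ M`), every scale-`0` thin multiplier `klAnisoFamily … klE0 0 a` has `(ℤ/2M) × (ℤ/L)²` character sum of `ℓ¹` norm
`≤ C₀·M·L²` — the index-`0` companion of `charSum_klAniso_single_le`. [cite: BenfattoGiulianiMastropietro2006, §2.7 (2.71a)] -/
theorem charSum_klAniso_zero_single_klEng :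
    ∃ C₀ : ℝ, 0 < C₀ ∧ ∀ (P : SplitConsts) (R : RenConsts) (c : ℝ), P.WF → R.WF2 → 0 < c → c ≤ klEngC₃6 P R →
      ∀ μ ∈ klWindowC, ∀ U : ℝ, 0 < U → U ≤ klEngU₀9 P R c → ∀ β : ℝ, klBetaMin ≤ β → β ≤ Real.exp (c / U ^ 2) →
      ∀ K : TrigPolyC4v, FrameOK R U (nScales β) μ K → ∀ (L M : ℕ) [NeZero L] [NeZero M],
      klEngL₃ β U ≤ L → klEngM₃ β U L ≤ M → ∀ a : Fin (sectorCount 0),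
        ∑ z : TorusSite 1 (2 * M) × TorusSite 2 L,
          ‖∑ q : TorusSite 1 (2 * M) × TorusSite 2 L, (torusChar q.1 z.1 * torusChar q.2 z.2) •
            klAnisoFamily L M β μ K klE0 0 a (⟨(q.1 0).val, ZMod.val_lt (q.1 0)⟩, q.2)‖ ≤ C₀ * M * (L : ℝ) ^ 2 := by
  have he : (0 : ℝ) < klE0 := by norm_num [klE0]
  have hβmin : (0 : ℝ) < klBetaMin := by norm_num [klBetaMin]
  have hB := sectorCircLineConst_nonneg
  obtain ⟨C₀, hC₀⟩ : ∃ C₀ : ℝ, C₀ = Real.sqrt (2048 * (16 * Real.pi / klE0 + 1) *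
            (4 * ((2 * Real.sqrt 2 / (2 / (Real.pi * ((22484224 / 9 + 7180 / 3 * sectorCircLineConst) + 1))) + 2) *
              (2 * Real.sqrt 2 / (2 / (Real.pi * ((22484224 / 9 + 7180 / 3 * sectorCircLineConst) + 1))) + 2)) +
              16 * (1 / (2 / (Real.pi * ((22484224 / 9 + 7180 / 3 * sectorCircLineConst) + 1))) + 1) ^ 2)) *
        Real.sqrt (64 * (1794 * klE0) * (klE0 / Real.pi + 1 / klBetaMin)) := ⟨_, rfl⟩
  have hC₀pos : 0 < C₀ := by
    rw [hC₀]
    refine mul_pos (Real.sqrt_pos.2 ?_) (Real.sqrt_pos.2 ?_)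
    · positivity
    · positivity
  refine ⟨C₀, hC₀pos, ?_⟩
  intro P R c hP hR2 hc hc6 μ hμ U hU hU9 β hβ hβc K hK L M _ _ hL3 hM3 a
  have hβpos : 0 < β := lt_of_lt_of_le hβmin hβ
  have hRj : ∀ j, 0 ≤ R.Gfr j := gfr_nonneg_of_wf2 hR2
  obtain ⟨hL15, -, hM2, hβM, -, hMβ⟩ := scaleZero_regime_sizes (U := U) hβ hL3 hM3
  have hκU : 16 / 15 * (R.Gfr 0 * |U|) ≤ 1 / 50 := gfr0_abs_mul_le_of_le_klEngU₀3 hU (hU9.trans (klEngU₀9_le_klEngU₀3 P R c))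
  have h4 := torusSum_klAnisoFamily_zero_le_CT hK hRj hμ hκU hL15 hβ hβM hM2 hMβ a 0
  simp only [if_true] at h4
  rw [← hC₀] at h4
  refine (charSum_le_of_padded_le hβpos.ne' _ h4).trans (le_of_eq ?_)
  rw [abs_of_pos hβpos]
  field_simp

/-! ## §3 The thin-index-`0` twins: overlap sums and THE n₂ = 0 DOOR -/

/-- **The per-pair overlap sums of `E(klIsoFamily m)·S(F̃_0)` in the KL regime** (`m ≥ 1`): `∃ C_I⁰ > 0`, under the binders of the registered stubs of
20437, column and row sums `≤ C_I⁰·M/β` — iso single from `isoTorusBoundAt_klIsoT`, thin single from `charSum_klAniso_zero_single_klEng`, product-torus Young.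
[cite: BenfattoGiulianiMastropietro2006, §2.7 (2.71a)] -/
theorem overlap_pairSums_klIso_zero_klEng :
    ∃ CI : ℝ, 0 < CI ∧ ∀ (P : SplitConsts) (R : RenConsts) (c : ℝ), P.WF → R.WF2 → 0 < c → c ≤ klEngC₃6 P R →
      ∀ μ ∈ klWindowC, ∀ U : ℝ, 0 < U → U ≤ klEngU₀9 P R c → ∀ β : ℝ, klBetaMin ≤ β → β ≤ Real.exp (c / U ^ 2) →
      ∀ K : TrigPolyC4v, FrameOK R U (nScales β) μ K → ∀ (L M : ℕ) [NeZero L] [NeZero M],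
      klEngL₃ β U ≤ L → klEngM₃ β U L ≤ M → ∀ m : ℕ, 1 ≤ m →
        (∀ (σ : Fin (sectorCount (2 * m))) (ω' : Fin (sectorCount 0)) (s c' : Fin 2) (x' : SpaceTimeIdx L M),
          ∑ x'' : SpaceTimeIdx L M, ‖(sectorAnalysisMatrix L M β (klIsoFamily L M β μ K klE0 m) *
            sectorSubMatrix L M β (bgmFatMultiplier L M klE0 β (nambuXiCT L μ K) 0)) (x'', ((σ, s), c')) (x', ((ω', s), c'))‖ ≤
            CI * M / β) ∧
        (∀ (σ : Fin (sectorCount (2 * m))) (ω' : Fin (sectorCount 0)) (s c' : Fin 2) (x'' : SpaceTimeIdx L M),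
          ∑ x' : SpaceTimeIdx L M, ‖(sectorAnalysisMatrix L M β (klIsoFamily L M β μ K klE0 m) *
            sectorSubMatrix L M β (bgmFatMultiplier L M klE0 β (nambuXiCT L μ K) 0)) (x'', ((σ, s), c')) (x', ((ω', s), c'))‖ ≤
            CI * M / β) := by
  have he : (0 : ℝ) < klE0 := by norm_num [klE0]
  obtain ⟨C₀, hC₀, h0⟩ := charSum_klAniso_zero_single_klEng
  have hI0 : 0 ≤ klIsoT := klIsoT_nonneg
  refine ⟨3 * (klIsoT + 1) * C₀, by positivity, ?_⟩
  intro P R c hP hR2 hc hc6 μ hμ U hU hU9 β hβmin hβc K hK L M _ _ hL3 hM3 m hm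
  have hβ : 0 < β := KLRegimeSplit.pos_of_klBetaMin_le hβmin
  have hLr : (0 : ℝ) < L := Nat.cast_pos.2 (Nat.pos_of_ne_zero (NeZero.ne L))
  have hMr : (0 : ℝ) < M := Nat.cast_pos.2 (Nat.pos_of_ne_zero (NeZero.ne M))
  have hsingle : ∀ a : Fin (sectorCount 0), ∑ z : TorusSite 1 (2 * M) × TorusSite 2 L,
      ‖∑ q : TorusSite 1 (2 * M) × TorusSite 2 L, (torusChar q.1 z.1 * torusChar q.2 z.2) •
        klAnisoFamily L M β μ K klE0 0 a (⟨(q.1 0).val, ZMod.val_lt (q.1 0)⟩, q.2)‖ ≤ C₀ * M * (L : ℝ) ^ 2 :=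
    fun a => h0 P R c hP hR2 hc hc6 μ hμ U hU hU9 β hβmin hβc K hK L M hL3 hM3 a
  have hiso : ∀ σ : Fin (sectorCount (2 * m)), ∑ z : TorusSite 1 (2 * M) × TorusSite 2 L,
      ‖∑ q : TorusSite 1 (2 * M) × TorusSite 2 L, (torusChar q.1 z.1 * torusChar q.2 z.2) •
        klIsoFamily L M β μ K klE0 m σ (⟨(q.1 0).val, ZMod.val_lt (q.1 0)⟩, q.2)‖ ≤ 2 * M * (L : ℝ) ^ 2 * (klIsoT + 1) := by
    intro σ
    have h4 := (TorusFourierL2.isoTorusBoundAt_klIsoT : IsoTorusBoundAt klIsoT) P R c hP hR2 hc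
      (hc6.trans (klEngC₃6_le_klEngC₃3 P R)) μ hμ U hU (hU9.trans (klEngU₀9_le_klEngU₀3 P R c)) β hβmin hβc K hK L M hL3 hM3 m σ 0
    simp only [if_true] at h4
    have h5 := charSum_klIso_single_le_of_padded hβ μ K klE0 m σ h4
    refine h5.trans ?_
    exact mul_le_mul_of_nonneg_left (by linarith) (by positivity)
  have hTi0 : 0 ≤ 2 * M * (L : ℝ) ^ 2 * (klIsoT + 1) := by positivity
  have hTa0 : 0 ≤ C₀ * M * (L : ℝ) ^ 2 := by positivity
  have hpr := overlap_pairSums_klIso_bgmFat_le_of_singles he hβ μ K (show 0 + 1 ≤ m from hm) hTi0 hTa0 hiso hsingle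
  have hval : 3 * ((((2 * M : ℕ) : ℝ) ^ 1 * (L : ℝ) ^ 2)⁻¹ * ((2 * M * (L : ℝ) ^ 2 * (klIsoT + 1)) * (C₀ * M * (L : ℝ) ^ 2))) /
      (β * (L : ℝ) ^ 2) = 3 * (klIsoT + 1) * C₀ * M / β := by
    push_cast
    field_simp
  refine ⟨fun σ ω' s c' x' => ?_, fun σ ω' s c' x'' => ?_⟩
  · exact (hpr.2 σ ω' s c' x').trans (le_of_eq hval)
  · exact (hpr.1 σ ω' s c' x'').trans (le_of_eq hval)

/-- **The iso ← thin(0) door, fixed-tuple form**: `∃ C_re⁰ > 0` such that, under the binders of the registered stubs of 20437 at an admissible frame `K`, for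
every scale `n` and size `X ≥ 0`: if every thin label tuple `σ′` of index `0`, leg `p` and point `y` has `ε³·Σ_{x′_p=y}‖klAnisoKernelAt … K n 0 σ′ x′‖ ≤ X`,
then for every resolution `m ≥ 1`, every iso tuple `Ω` and every `x₁`: `fixedTupleL1 β 3 (klIsoKernelAt … K n m) Ω x₁ ≤ C_re⁰·X`.
[cite: BenfattoGiulianiMastropietro2006, §2.8 (2.82)-(2.83)] -/
theorem fixedTupleL1_klIsoKernelAt_le_klEng_zero :
    ∃ Cre : ℝ, 0 < Cre ∧ ∀ (P : SplitConsts) (R : RenConsts) (c : ℝ), P.WF → R.WF2 → 0 < c → c ≤ klEngC₃6 P R →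
      ∀ μ ∈ klWindowC, ∀ U : ℝ, 0 < U → U ≤ klEngU₀9 P R c → ∀ β : ℝ, klBetaMin ≤ β → β ≤ Real.exp (c / U ^ 2) →
      ∀ K : TrigPolyC4v, FrameOK R U (nScales β) μ K → ∀ (L M : ℕ) [NeZero L] [NeZero M],
      klEngL₃ β U ≤ L → klEngM₃ β U L ≤ M → ∀ n : ℕ, ∀ X : ℝ, 0 ≤ X →
        (∀ (σ' : Fin 4 → SectorLeg (sectorCount 0)) (p : Fin 4) (y : SpaceTimeIdx L M),
          imagTimeWeight β M ^ 3 * ∑ x' ∈ univ.filter (fun x' : Fin 4 → SpaceTimeIdx L M => x' p = y),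
            ‖klAnisoKernelAt L M β U μ K n 0 σ' x'‖ ≤ X) →
        ∀ m : ℕ, 1 ≤ m → ∀ (Ω : Fin 4 → SectorLeg (sectorCount (2 * m))) (x₁ : SpaceTimeIdx L M),
          fixedTupleL1 L M β 3 (klIsoKernelAt L M β U μ K n m) Ω x₁ ≤ Cre * X := by
  obtain ⟨CI, hCI, hI⟩ := overlap_pairSums_klIso_zero_klEng
  refine ⟨(CI / 2) ^ 4 * 27 ^ 4, by positivity, ?_⟩
  intro P R c hP hR2 hc hc6 μ hμ U hU hU9 β hβmin hβc K hK L M _ _ hL3 hM3 n X hX0 hB m hm Ω x₁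
  have hβ : 0 < β := KLRegimeSplit.pos_of_klBetaMin_le hβmin
  have hMr : (0 : ℝ) < M := Nat.cast_pos.2 (Nat.pos_of_ne_zero (NeZero.ne M))
  obtain ⟨hcol, hrow⟩ := hI P R c hP hR2 hc hc6 μ hμ U hU hU9 β hβmin hβc K hK L M hL3 hM3 m hm
  have hc0 : 0 ≤ CI * M / β := by positivity
  refine (fixedTupleL1_klIsoKernelAt_le_of_klAniso hβ U μ K n (show 0 + 1 ≤ m from hm) hc0 hc0 hX0 hcol hrow hB Ω x₁).trans
    (le_of_eq ?_)
  rw [imagTimeWeight]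
  field_simp

/-- **THE n₂ = 0 DOOR** (`IsoTupleLineAt` from a per-thin-tuple line at thin index `0`): `∃ C_re⁰ > 0` such that, under the binders of the registered stubs of
item 20437 at the flowing frame `K_n = klFlowFrameU L M β U μ n` (`FrameOK R U (nScales β) μ K_n`), for every `1 ≤ n` and constants `a, b` with
`0 ≤ a·U + b·(Klam U)²`: if every thin label tuple `σ′` of index `0`, leg `p` and point `y` has `ε³·Σ_{x′_p=y}‖klAnisoKernelAt … K_n n 0 σ′ x′‖ ≤ a·U + b·(Klam U)²`,
then `IsoTupleLineAt L M (C_re⁰·a) (C_re⁰·b) P β U μ n` — the case `n = 1` (producer's index `n − 1 = 0`) of the class-#6 line; with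
`isoTupleLineAt_of_anisoTupleLine_klEng` every `n ≥ 1` is covered. [cite: BenfattoGiulianiMastropietro2006, §2.8 (2.82)-(2.83)] -/
theorem isoTupleLineAt_of_anisoTupleLine_zero_klEng :
    ∃ Cre : ℝ, 0 < Cre ∧ ∀ (P : SplitConsts) (R : RenConsts) (c : ℝ), P.WF → R.WF2 → 0 < c → c ≤ klEngC₃6 P R →
      ∀ μ ∈ klWindowC, ∀ U : ℝ, 0 < U → U ≤ klEngU₀9 P R c → ∀ β : ℝ, klBetaMin ≤ β → β ≤ Real.exp (c / U ^ 2) →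
      ∀ (L M : ℕ) [NeZero L] [NeZero M], klEngL₃ β U ≤ L → klEngM₃ β U L ≤ M →
      ∀ n : ℕ, 1 ≤ n → FrameOK R U (nScales β) μ (klFlowFrameU L M β U μ n) → ∀ a b : ℝ, 0 ≤ a * U + b * (P.Klam * U) ^ 2 →
        (∀ (σ' : Fin 4 → SectorLeg (sectorCount 0)) (p : Fin 4) (y : SpaceTimeIdx L M),
          imagTimeWeight β M ^ 3 * ∑ x' ∈ univ.filter (fun x' : Fin 4 → SpaceTimeIdx L M => x' p = y),
            ‖klAnisoKernelAt L M β U μ (klFlowFrameU L M β U μ n) n 0 σ' x'‖ ≤ a * U + b * (P.Klam * U) ^ 2) →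
        IsoTupleLineAt L M (Cre * a) (Cre * b) P β U μ n := by
  obtain ⟨Cre, hCre, h⟩ := fixedTupleL1_klIsoKernelAt_le_klEng_zero
  refine ⟨Cre, hCre, ?_⟩
  intro P R c hP hR2 hc hc6 μ hμ U hU hU9 β hβmin hβc L M _ _ hL3 hM3 n hn hK a b hab hB m hnm Ω _ x₁
  have hm : 1 ≤ m := hn.trans hnm
  refine (h P R c hP hR2 hc hc6 μ hμ U hU hU9 β hβmin hβc (klFlowFrameU L M β U μ n) hK L M hL3 hM3 n
    (a * U + b * (P.Klam * U) ^ 2) hab hB m hm Ω x₁).trans (le_of_eq ?_)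
  ring

end Summit.HubbardSuperconductivity.HubbardSuperconductivity.Theorems.EngineV8

end
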